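import Summits.QuantumFields.YangMills.Theorems.ColdStartUniversalityShenZhuZhuTalagrandSU2
import Mathlib.Probability.Moments.SubGaussian
import Mathlib.Probability.Moments.MGFAnalytic
import HarnessLib

/-!
# GAUSSIAN CONCENTRATION OF LIPSCHITZ OBSERVABLES UNDER THE `SU(2)` WILSON–GIBBS MEASURE on `(ℤ/L)³` at `|β'| < 1/12`, uniformly in the volume:
# `F − ∫F dμ_(β')` is SUB-GAUSSIAN with variance proxy `L_F²/(1 − 12|β'|)` for every `ρ_L`-Lipschitz `F`, hence `μ_(β')(F − ∫F ≥ r) ≤ exp(−(1−12|β'|)r²/(2L_F²))`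
# (Herbst's argument from the volume-uniform log-Sobolev inequality)

Seat `ym-line-csu-p1` (g42), route `ColdStartUniversality` of `Summits/QuantumFields/YangMills`, helper file G71 (`--supports stmt-QuantumFields-24809`).
§1 is GENERIC (any probability space) — Herbst's argument without limits at `t = 0`: the entropy bound says that `K(t) = t⁻¹ log ∫e^{tF}dμ − ct/2` has
non-positive derivative on `(0, ∞)` (Mathlib's `hasDerivAt_mgf`), so `K(t) ≤ K(t₀)` for `0 < t₀ ≤ t`, and `K(t₀) ≤ ∫F dμ + t₀M²/2` by Hoeffding's lemma
(G69c `log_integral_exp_le_of_abs_le`); `t₀ → 0` gives `log ∫e^{tF}dμ ≤ t∫F dμ + ct²/2`, i.e. Mathlib's `HasSubgaussianMGF (F − ∫F dμ) c μ`.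
§2 feeds the log-Sobolev inequality for Lipschitz exponentials of G70b (`wilson_logSobolev_exp_local`, constant majorant `G ≡ |t|L_F`) into §1.

* ★★ `log_mgf_le_of_entropy_le`, ★★★ `hasSubgaussianMGF_of_entropy_le` — generic Herbst;
* ★★ `wilson_lipschitz_entropy_exp_le` — `Ent_(μ_β')(e^{tF}) ≤ (L_F²/(1−12|β'|))·(t²/2)·∫e^{tF}dμ_(β')` for `ρ_L`-Lipschitz `F`, all real `t`;
* ★★★★ **`wilson_lipschitz_hasSubgaussianMGF`** — `HasSubgaussianMGF (F − ∫F dμ_(β')) (L_F²/(1−12|β'|)) μ_(β')`, every `L`;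
* ★★★ `wilson_lipschitz_mgf_le` — `∫e^{t(F − ∫F)}dμ_(β') ≤ exp(L_F² t²/(2(1−12|β'|)))`;
* ★★★★ **`wilson_lipschitz_concentration`** — `μ_(β'){r ≤ F − ∫F dμ_(β')} ≤ exp(−r²(1−12|β'|)/(2L_F²))` for `r ≥ 0`, every `L`.

THEOREMS ONLY, no definition, no sorry.  HONEST FRAMING: fixed cut-off, finite volume, `|β'| < 1/12`; "uniform" = constants independent of `L`;
nothing `K`-uniform along the route's scaling; `UniformColdStartMixing` (24809, ASIDE) is not restated; no crux, rung or summit statement is proved;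
the Yang–Mills mass gap is NOT proved.
-/

set_option autoImplicit false

noncomputable section

namespace Summit.QuantumFields.YangMills.Theorems.ColdStartUniversality

open MeasureTheory ProbabilityTheory Filter Topology Set Real
open Literature.Probability.Process Literature.MathematicalPhysics.QuantumFieldTheory
open Literature.MathematicalPhysics.QuantumLattice (fundamentalRep fundamentalLatticeRep continuous_fundamentalRep)

/-! ## §1. Herbst's argument (generic) -/

section Herbst

variable {Ω : Type*} [MeasurableSpace Ω]

/-- ★★ **Herbst's bound for `t > 0`.**  On a probability space, let `F` be measurable with `|F| ≤ M`, and suppose the entropy bound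
`∫ tF e^{tF} dμ − (∫e^{tF}dμ) log ∫e^{tF}dμ ≤ (ct²/2)·∫e^{tF}dμ` for every `t > 0` (`c ≥ 0`).  Then `log ∫ e^{tF} dμ ≤ t·∫F dμ + ct²/2` for every
`t > 0`. [cite: BakryGentilLedoux2014, Prop 5.4.1] -/
theorem log_mgf_le_of_entropy_le (μ : Measure Ω) [IsProbabilityMeasure μ] {F : Ω → ℝ} (hFm : Measurable F) {M : ℝ} (hM : ∀ ω, |F ω| ≤ M)
    {c : ℝ} (hc : 0 ≤ c)
    (hEnt : ∀ t : ℝ, 0 < t → ∫ ω, t * F ω * exp (t * F ω) ∂μ - (∫ ω, exp (t * F ω) ∂μ) * log (∫ ω, exp (t * F ω) ∂μ) ≤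
      c * t ^ 2 / 2 * ∫ ω, exp (t * F ω) ∂μ)
    {t : ℝ} (ht : 0 < t) :
    log (∫ ω, exp (t * F ω) ∂μ) ≤ t * ∫ ω, F ω ∂μ + c * t ^ 2 / 2 := by
  -- integrability of all exponential moments
  have hbd : ∀ (s : ℝ) (ω : Ω), exp (s * F ω) ∈ Set.Icc (0 : ℝ) (exp (|s| * M)) := fun s ω =>
    ⟨(exp_pos _).le, exp_le_exp.2 (by
      calc s * F ω ≤ |s * F ω| := le_abs_self _
        _ = |s| * |F ω| := abs_mul _ _
        _ ≤ |s| * M := mul_le_mul_of_nonneg_left (hM ω) (abs_nonneg _))⟩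
  have hint : ∀ s : ℝ, Integrable (fun ω => exp (s * F ω)) μ := fun s =>
    (memLp_of_bounded (ae_of_all _ (hbd s)) ((measurable_exp.comp (hFm.const_mul s)).aestronglyMeasurable) 1).integrable le_rfl
  have hset : interior (integrableExpSet F μ) = Set.univ := by
    have h1 : integrableExpSet F μ = Set.univ := Set.eq_univ_of_forall fun s => hint s
    rw [h1, interior_univ]
  have hpos : ∀ s : ℝ, 0 < mgf F μ s := fun s => mgf_pos (hint s)
  have hder : ∀ s : ℝ, HasDerivAt (mgf F μ) (∫ ω, F ω * exp (s * F ω) ∂μ) s := fun s =>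
    hasDerivAt_mgf (by rw [hset]; trivial)
  -- the function `K`
  have hK : ∀ s : ℝ, 0 < s → HasDerivAt (fun s => log (mgf F μ s) / s - c * s / 2)
      (((∫ ω, F ω * exp (s * F ω) ∂μ) / mgf F μ s * s - log (mgf F μ s) * 1) / s ^ 2 - c * 1 / 2) s := by
    intro s hs
    have h1 : HasDerivAt (fun s => log (mgf F μ s)) ((∫ ω, F ω * exp (s * F ω) ∂μ) / mgf F μ s) s := (hder s).log (hpos s).ne'
    have h2 := h1.div (hasDerivAt_id s) hs.ne'
    have h3 : HasDerivAt (fun s : ℝ => c * s / 2) (c * 1 / 2) s := ((hasDerivAt_id s).const_mul c).div_const 2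
    exact h2.sub h3
  have hKle : ∀ s : ℝ, 0 < s → ((∫ ω, F ω * exp (s * F ω) ∂μ) / mgf F μ s * s - log (mgf F μ s) * 1) / s ^ 2 - c * 1 / 2 ≤ 0 := by
    intro s hs
    have hE := hEnt s hs
    have hΛ : ∫ ω, exp (s * F ω) ∂μ = mgf F μ s := by rw [mgf]
    have hD : ∫ ω, s * F ω * exp (s * F ω) ∂μ = s * ∫ ω, F ω * exp (s * F ω) ∂μ := by
      rw [← integral_const_mul]; exact integral_congr_ae (ae_of_all _ fun ω => by ring)
    rw [hΛ, hD] at hE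
    have hp := hpos s
    generalize (∫ ω, F ω * exp (s * F ω) ∂μ) = A at hE ⊢
    generalize mgf F μ s = Λ at hE hp ⊢
    rw [mul_one, mul_one, sub_nonpos, div_le_iff₀ (pow_pos hs 2)]
    -- `Λ'/Λ·s − log Λ ≤ (c/2) s²`  ⟸  `sΛ' − Λ log Λ ≤ (c s²/2) Λ`
    have h1 : A / Λ * s - log Λ = (s * A - Λ * log Λ) / Λ := by
      field_simp
    rw [h1, div_le_iff₀ hp]
    calc s * A - Λ * log Λ ≤ c * s ^ 2 / 2 * Λ := hE
      _ = c / 2 * s ^ 2 * Λ := by ring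
  have hanti : AntitoneOn (fun s => log (mgf F μ s) / s - c * s / 2) (Set.Ioi 0) := by
    refine antitoneOn_of_deriv_nonpos (convex_Ioi 0) ?_ ?_ ?_
    · exact fun s hs => (hK s hs).continuousAt.continuousWithinAt
    · rw [interior_Ioi]; exact fun s hs => (hK s hs).differentiableAt.differentiableWithinAt
    · rw [interior_Ioi]; intro s hs; rw [(hK s hs).deriv]; exact hKle s hs
  -- compare with small `t₀` and use Hoeffding there
  have hmain : ∀ t₀ : ℝ, 0 < t₀ → t₀ ≤ t → log (mgf F μ t) / t ≤ ∫ ω, F ω ∂μ + t₀ * M ^ 2 / 2 + c * t / 2 := by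
    intro t₀ ht₀ ht₀t
    have h1 := hanti (Set.mem_Ioi.2 ht₀) (Set.mem_Ioi.2 ht) ht₀t
    simp only at h1
    have h2 : 1 / t₀ * log (∫ ω, exp (t₀ * F ω) ∂μ) ≤ ∫ ω, F ω ∂μ + t₀ * M ^ 2 / 2 := log_integral_exp_le_of_abs_le μ hFm hM ht₀
    rw [one_div_mul_eq_div, ← mgf] at h2
    nlinarith
  have hfin : log (mgf F μ t) / t ≤ ∫ ω, F ω ∂μ + c * t / 2 := by
    refine le_of_forall_pos_lt_add fun ε hε => ?_
    have hM0 : 0 ≤ M ^ 2 := sq_nonneg M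
    obtain ⟨t₀, ht₀⟩ : ∃ t₀ : ℝ, t₀ = min t (ε / (M ^ 2 + 1)) := ⟨_, rfl⟩
    have ht₀0 : 0 < t₀ := by rw [ht₀]; exact lt_min ht (div_pos hε (by positivity))
    have ht₀t : t₀ ≤ t := by rw [ht₀]; exact min_le_left _ _
    have ht₀ε : t₀ * M ^ 2 / 2 < ε := by
      have h1 : t₀ ≤ ε / (M ^ 2 + 1) := by rw [ht₀]; exact min_le_right _ _
      have h2 : ε / (M ^ 2 + 1) * M ^ 2 ≤ ε := by
        rw [div_mul_eq_mul_div, div_le_iff₀ (by positivity)]; nlinarith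
      nlinarith [mul_le_mul_of_nonneg_right h1 hM0]
    linarith [hmain t₀ ht₀0 ht₀t]
  have h := (div_le_iff₀ ht).1 hfin
  rw [mgf] at h
  linarith [h]

/-- ★★★ **Herbst ⇒ sub-Gaussian.**  On a probability space, let `F` be measurable with `|F| ≤ M` and suppose the entropy bound
`∫ tF e^{tF} dμ − (∫e^{tF}dμ) log ∫e^{tF}dμ ≤ (ct²/2)·∫e^{tF}dμ` for EVERY real `t`.  Then `F − ∫F dμ` has sub-Gaussian moment generating
function with variance proxy `c`:  `∫ e^{t(F − ∫F dμ)} dμ ≤ e^{ct²/2}` for all `t` (Mathlib's `HasSubgaussianMGF`; Chernoff then gives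
`μ(F − ∫F dμ ≥ r) ≤ e^{−r²/(2c)}`, `HasSubgaussianMGF.measure_ge_le`). [cite: BakryGentilLedoux2014, Prop 5.4.1] -/
theorem hasSubgaussianMGF_of_entropy_le (μ : Measure Ω) [IsProbabilityMeasure μ] {F : Ω → ℝ} (hFm : Measurable F) {M : ℝ} (hM : ∀ ω, |F ω| ≤ M)
    {c : NNReal}
    (hEnt : ∀ t : ℝ, ∫ ω, t * F ω * exp (t * F ω) ∂μ - (∫ ω, exp (t * F ω) ∂μ) * log (∫ ω, exp (t * F ω) ∂μ) ≤
      (c : ℝ) * t ^ 2 / 2 * ∫ ω, exp (t * F ω) ∂μ) :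
    HasSubgaussianMGF (fun ω => F ω - ∫ ω', F ω' ∂μ) c μ := by
  have hc : 0 ≤ (c : ℝ) := c.2
  have hbd : ∀ (s : ℝ) (G : Ω → ℝ) (MG : ℝ), (∀ ω, |G ω| ≤ MG) → ∀ ω, exp (s * G ω) ∈ Set.Icc (0 : ℝ) (exp (|s| * MG)) := fun s G MG hG ω =>
    ⟨(exp_pos _).le, exp_le_exp.2 (by
      calc s * G ω ≤ |s * G ω| := le_abs_self _
        _ = |s| * |G ω| := abs_mul _ _
        _ ≤ |s| * MG := mul_le_mul_of_nonneg_left (hG ω) (abs_nonneg _))⟩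
  have hint : ∀ (s : ℝ) (G : Ω → ℝ) (MG : ℝ), Measurable G → (∀ ω, |G ω| ≤ MG) → Integrable (fun ω => exp (s * G ω)) μ := fun s G MG hGm hG =>
    (memLp_of_bounded (ae_of_all _ (hbd s G MG hG)) ((measurable_exp.comp (hGm.const_mul s)).aestronglyMeasurable) 1).integrable le_rfl
  obtain ⟨m, hm⟩ : ∃ m : ℝ, m = ∫ ω', F ω' ∂μ := ⟨_, rfl⟩
  rw [← hm]
  have hMm : ∀ ω, |F ω - m| ≤ M + |m| := fun ω => (abs_sub _ _).trans (by linarith [hM ω])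
  refine ⟨fun s => hint s _ (M + |m|) (hFm.sub_const m) hMm, fun t => ?_⟩
  have hshift : mgf (fun ω => F ω - m) μ t = exp (-(t * m)) * ∫ ω, exp (t * F ω) ∂μ := by
    simp only [sub_eq_add_neg]
    rw [mgf_add_const, mgf, mul_neg, mul_comm]
  rw [hshift]
  rcases lt_trichotomy t 0 with ht | ht | ht
  · -- `t < 0`: apply the positive case to `−F` at `−t`
    have hEnt' : ∀ s : ℝ, 0 < s → ∫ ω, s * (-F ω) * exp (s * (-F ω)) ∂μ - (∫ ω, exp (s * (-F ω)) ∂μ) * log (∫ ω, exp (s * (-F ω)) ∂μ) ≤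
        (c : ℝ) * s ^ 2 / 2 * ∫ ω, exp (s * (-F ω)) ∂μ := by
      intro s _
      have h := hEnt (-s)
      have e1 : ∀ ω, -s * F ω = s * (-F ω) := fun ω => by ring
      simp only [e1] at h
      rw [show (c : ℝ) * (-s) ^ 2 / 2 = (c : ℝ) * s ^ 2 / 2 by ring] at h
      exact h
    have h := log_mgf_le_of_entropy_le μ hFm.neg (M := M) (fun ω => by rw [Pi.neg_apply, abs_neg]; exact hM ω) hc hEnt' (neg_pos.2 ht)
    simp only [Pi.neg_apply, integral_neg, neg_mul, mul_neg, neg_neg] at h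
    rw [← hm] at h
    have hp : 0 < ∫ ω, exp (t * F ω) ∂μ := by have := mgf_pos (hint t F M hFm hM); rwa [mgf] at this
    calc exp (-(t * m)) * ∫ ω, exp (t * F ω) ∂μ = exp (-(t * m)) * exp (log (∫ ω, exp (t * F ω) ∂μ)) := by rw [exp_log hp]
      _ ≤ exp (-(t * m)) * exp (t * m + (c : ℝ) * (-t) ^ 2 / 2) := mul_le_mul_of_nonneg_left (exp_le_exp.2 h) (exp_pos _).le
      _ = exp ((c : ℝ) * t ^ 2 / 2) := by rw [← exp_add]; ring_nf
  · subst ht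
    simp
  · have h := log_mgf_le_of_entropy_le μ hFm hM hc (fun s _ => hEnt s) ht
    rw [← hm] at h
    have hp : 0 < ∫ ω, exp (t * F ω) ∂μ := by have := mgf_pos (hint t F M hFm hM); rwa [mgf] at this
    calc exp (-(t * m)) * ∫ ω, exp (t * F ω) ∂μ = exp (-(t * m)) * exp (log (∫ ω, exp (t * F ω) ∂μ)) := by rw [exp_log hp]
      _ ≤ exp (-(t * m)) * exp (t * m + (c : ℝ) * t ^ 2 / 2) := mul_le_mul_of_nonneg_left (exp_le_exp.2 h) (exp_pos _).le
      _ = exp ((c : ℝ) * t ^ 2 / 2) := by rw [← exp_add]; ring_nf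

end Herbst

/-! ## §2. Lipschitz observables of the Wilson–Gibbs measure are sub-Gaussian, uniformly in the volume -/

/-- ★★ **Entropy bound for Lipschitz exponentials.**  For `|β'| < 1/12`, every `L`, every `ρ_L`-Lipschitz `F : SU(2)^E → ℝ` (constant `L_F ≥ 0`) and
every real `t`, with `μ = μ_(β')`:  `∫ tF e^{tF} dμ − (∫e^{tF}dμ) log ∫e^{tF}dμ ≤ (L_F²/(1 − 12|β'|))·(t²/2)·∫e^{tF}dμ`
(G70b's `wilson_logSobolev_exp_local` with the constant majorant `|t|L_F`). [cite: ShenZhuZhu2022, §4 Corollary 4.4 (4.12)] -/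
theorem wilson_lipschitz_entropy_exp_le (L : ℕ) [NeZero L] (β' : ℝ) (hβ : |β'| < 1 / 12)
    {F : GaugeConfig 3 L (Matrix.specialUnitaryGroup (Fin 2) ℂ) → ℝ} {Lf : ℝ} (hLf : 0 ≤ Lf)
    (hlip : ∀ Q Q', |F Q' - F Q| ≤ Lf * Real.sqrt (torusRiemannDistSq (fundamentalLatticeRep 2) Q Q')) (t : ℝ) :
    ∫ x, t * F x * exp (t * F x) ∂(wilsonMeasure (d := 3) (L := L) (fundamentalRep (Fin 2)) β') -
        (∫ x, exp (t * F x) ∂(wilsonMeasure (d := 3) (L := L) (fundamentalRep (Fin 2)) β')) *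
          log (∫ x, exp (t * F x) ∂(wilsonMeasure (d := 3) (L := L) (fundamentalRep (Fin 2)) β')) ≤
      Lf ^ 2 / (1 - 12 * |β'|) * t ^ 2 / 2 * ∫ x, exp (t * F x) ∂(wilsonMeasure (d := 3) (L := L) (fundamentalRep (Fin 2)) β') := by
  have hLt : 0 ≤ |t| * Lf := mul_nonneg (abs_nonneg t) hLf
  have hlipt : ∀ Q Q' : GaugeConfig 3 L (Matrix.specialUnitaryGroup (Fin 2) ℂ), |t * F Q' - t * F Q| ≤ |t| * Lf * Real.sqrt (torusRiemannDistSq (fundamentalLatticeRep 2) Q Q') :=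
    fun Q Q' => by
      rw [← mul_sub, abs_mul, mul_assoc]
      exact mul_le_mul_of_nonneg_left (hlip Q Q') (abs_nonneg t)
  have hloc : ∀ w z' z'' : GaugeConfig 3 L (Matrix.specialUnitaryGroup (Fin 2) ℂ),
      Real.sqrt (torusRiemannDistSq (fundamentalLatticeRep 2) w z') ≤ 1 → Real.sqrt (torusRiemannDistSq (fundamentalLatticeRep 2) w z'') ≤ 1 →
        |t * F z'' - t * F z'| ≤ (fun _ => |t| * Lf) w * Real.sqrt (torusRiemannDistSq (fundamentalLatticeRep 2) z' z'') :=
    fun w z' z'' _ _ => hlipt z' z''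
  have h := wilson_logSobolev_exp_local L β' hβ hLt hlipt one_pos (G := fun _ => |t| * Lf) upperSemicontinuous_const (M := |t| * Lf)
    (fun _ => hLt) (fun _ => le_rfl) hloc
  have e1 : ∫ x, (fun _ : GaugeConfig 3 L (Matrix.specialUnitaryGroup (Fin 2) ℂ) => |t| * Lf) x ^ 2 * exp (t * F x) ∂(wilsonMeasure (d := 3) (L := L) (fundamentalRep (Fin 2)) β') =
      (|t| * Lf) ^ 2 * ∫ x, exp (t * F x) ∂(wilsonMeasure (d := 3) (L := L) (fundamentalRep (Fin 2)) β') := by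
    rw [← integral_const_mul]
  rw [e1, mul_pow, sq_abs] at h
  calc _ ≤ 1 / (1 - 12 * |β'|) / 2 * (t ^ 2 * Lf ^ 2 * ∫ x, exp (t * F x) ∂(wilsonMeasure (d := 3) (L := L) (fundamentalRep (Fin 2)) β')) := h
    _ = _ := by ring

/-- ★★★★ **Lipschitz observables of the Wilson–Gibbs measure are sub-Gaussian, uniformly in the volume.**  For `|β'| < 1/12`, every `L` and every
`ρ_L`-Lipschitz `F : SU(2)^E → ℝ` with constant `L_F`:  `HasSubgaussianMGF (F − ∫F dμ_(β')) (L_F²/(1 − 12|β'|)) μ_(β')`, i.e.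
`∫ e^{t(F − ∫F dμ_(β'))} dμ_(β') ≤ exp(L_F² t²/(2(1 − 12|β'|)))` for all real `t` (Herbst's argument on the volume-uniform log-Sobolev inequality).
[cite: BakryGentilLedoux2014, Prop 5.4.1] [cite: ShenZhuZhu2022, §4 Corollary 4.4 (4.12)] -/
theorem wilson_lipschitz_hasSubgaussianMGF (L : ℕ) [NeZero L] (β' : ℝ) (hβ : |β'| < 1 / 12)
    {F : GaugeConfig 3 L (Matrix.specialUnitaryGroup (Fin 2) ℂ) → ℝ} {Lf : ℝ} (hLf : 0 ≤ Lf)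
    (hlip : ∀ Q Q', |F Q' - F Q| ≤ Lf * Real.sqrt (torusRiemannDistSq (fundamentalLatticeRep 2) Q Q')) :
    HasSubgaussianMGF (fun x => F x - ∫ y, F y ∂(wilsonMeasure (d := 3) (L := L) (fundamentalRep (Fin 2)) β'))
      (Real.toNNReal (Lf ^ 2 / (1 - 12 * |β'|))) (wilsonMeasure (d := 3) (L := L) (fundamentalRep (Fin 2)) β') := by
  classical
  haveI := secondCountableTopology_su2
  haveI := borelSpace_config L
  haveI : IsProbabilityMeasure (wilsonMeasure (d := 3) (L := L) (fundamentalRep (Fin 2)) β') :=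
    isProbabilityMeasure_wilsonMeasure (d := 3) (L := L) (fundamentalRep (Fin 2)) (continuous_fundamentalRep (Fin 2)) β'
  have hc0 : 0 ≤ Lf ^ 2 / (1 - 12 * |β'|) := div_nonneg (sq_nonneg _) (by linarith)
  have hFc : Continuous F := continuous_of_riemannLipschitz hlip
  obtain ⟨MF, hMF'⟩ := (isCompact_range (continuous_abs.comp hFc)).bddAbove
  have hMF : ∀ x, |F x| ≤ MF := fun x => hMF' ⟨x, rfl⟩
  refine hasSubgaussianMGF_of_entropy_le (wilsonMeasure (d := 3) (L := L) (fundamentalRep (Fin 2)) β') hFc.measurable hMF fun t => ?_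
  rw [Real.coe_toNNReal _ hc0]
  exact wilson_lipschitz_entropy_exp_le L β' hβ hLf hlip t

/-- ★★★ **Laplace-transform bound.**  For `|β'| < 1/12`, every `L`, every `ρ_L`-Lipschitz `F` (constant `L_F`) and every real `t`:
`∫ exp(t·(F − ∫F dμ_(β'))) dμ_(β') ≤ exp((L_F²/(1 − 12|β'|))·t²/2)`. [cite: BakryGentilLedoux2014, Prop 5.4.1] -/
theorem wilson_lipschitz_mgf_le (L : ℕ) [NeZero L] (β' : ℝ) (hβ : |β'| < 1 / 12)
    {F : GaugeConfig 3 L (Matrix.specialUnitaryGroup (Fin 2) ℂ) → ℝ} {Lf : ℝ} (hLf : 0 ≤ Lf)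
    (hlip : ∀ Q Q', |F Q' - F Q| ≤ Lf * Real.sqrt (torusRiemannDistSq (fundamentalLatticeRep 2) Q Q')) (t : ℝ) :
    ∫ x, exp (t * (F x - ∫ y, F y ∂(wilsonMeasure (d := 3) (L := L) (fundamentalRep (Fin 2)) β'))) ∂(wilsonMeasure (d := 3) (L := L) (fundamentalRep (Fin 2)) β') ≤
      exp (Lf ^ 2 / (1 - 12 * |β'|) * t ^ 2 / 2) := by
  have h := (wilson_lipschitz_hasSubgaussianMGF L β' hβ hLf hlip).mgf_le t
  have hc0 : 0 ≤ Lf ^ 2 / (1 - 12 * |β'|) := div_nonneg (sq_nonneg _) (by linarith)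
  rw [Real.coe_toNNReal _ hc0, mgf] at h
  exact h

/-- ★★★★ **Gaussian concentration of Lipschitz observables, uniformly in the volume.**  For `|β'| < 1/12`, every `L`, every `ρ_L`-Lipschitz
`F : SU(2)^E → ℝ` with constant `L_F` and every `r ≥ 0`:  `μ_(β'){x | r ≤ F(x) − ∫F dμ_(β')} ≤ exp(−r²(1 − 12|β'|)/(2L_F²))`
(Chernoff on the sub-Gaussian bound; for `L_F = 0` both sides read `≤ 1`). [cite: BakryGentilLedoux2014, Prop 5.4.1] [cite: ShenZhuZhu2022, §4 Corollary 4.4] -/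
theorem wilson_lipschitz_concentration (L : ℕ) [NeZero L] (β' : ℝ) (hβ : |β'| < 1 / 12)
    {F : GaugeConfig 3 L (Matrix.specialUnitaryGroup (Fin 2) ℂ) → ℝ} {Lf : ℝ} (hLf : 0 ≤ Lf)
    (hlip : ∀ Q Q', |F Q' - F Q| ≤ Lf * Real.sqrt (torusRiemannDistSq (fundamentalLatticeRep 2) Q Q')) {r : ℝ} (hr : 0 ≤ r) :
    (wilsonMeasure (d := 3) (L := L) (fundamentalRep (Fin 2)) β').real
        {x | r ≤ F x - ∫ y, F y ∂(wilsonMeasure (d := 3) (L := L) (fundamentalRep (Fin 2)) β')} ≤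
      exp (-(r ^ 2 * (1 - 12 * |β'|) / (2 * Lf ^ 2))) := by
  have h := (wilson_lipschitz_hasSubgaussianMGF L β' hβ hLf hlip).measure_ge_le hr
  have hc0 : 0 ≤ Lf ^ 2 / (1 - 12 * |β'|) := div_nonneg (sq_nonneg _) (by linarith)
  rw [Real.coe_toNNReal _ hc0] at h
  have hc : (1 - 12 * |β'|) ≠ 0 := by
    have : 0 < 1 - 12 * |β'| := by linarith
    exact this.ne'
  have e : -r ^ 2 / (2 * (Lf ^ 2 / (1 - 12 * |β'|))) = -(r ^ 2 * (1 - 12 * |β'|) / (2 * Lf ^ 2)) := by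
    rw [mul_div_assoc', div_div_eq_mul_div, neg_mul, neg_div]
  rw [e] at h
  exact h

end Summit.QuantumFields.YangMills.Theorems.ColdStartUniversality

end
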